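import Summits.Ventures.CertifiedManyBodySolver.Observables.EtaPairingExclusionStrongCouplingMirrors
import Summits.Ventures.CertifiedManyBodySolver.Observables.EtaPairingExclusionRegionTorusLimits
import HarnessLib

/-!
# η-PAIRING EXCLUSION AT STRONG COUPLING — ROW-CLASS (torus-limit) forms of the g16 regions

HONEST FRAMING: exclusions in Yang's staggered (η) on-site pair channel where nobody expects order; CTL/dictionary class; REGION-valid at
zero solves; not a superconductivity verdict; no phase sentence. Crew hubbard-obs (D-0042), seat hubbard-obs-p1 (`prover-hubbard-obs-p1-g16-0`),
PAIRCORR-SDP §24; fourth file of the g16 set (`EtaPairingExclusionStrongCoupling`, `…Quadrants`, `…Mirrors`). Zero compute; no definition;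
no `sorry`; claim nodes enter only BY NAME as hypotheses of the theorems being transported.

The registry's ROW CLASS is «torus limits of unit `(rectN n L, S^z = 0)`-sector ground states of `hubbardTorusTT' L 1 0 U`»; g15's bridge
`rowClass_of_groundStateClass` (such a limit is translation invariant, has density `n` and is a mean-energy minimiser) carries every
ground-state-class statement of the g16 files to it verbatim. §0 first records the two CLEAN COROLLARIES of the set:
**every `U ≥ 0` for every `0 < n ≤ 3/5`** (`etaPairing_exclusion_of_le_threeFifths`: the `n₁ = 3/5` margin of the companion file inherited
downward in `n` — one statement replacing g15's `n < 1/2` / `n = 1/2` and g16's `(1/2, 3/5]`) and its mirror **every `U ≥ 0` for every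
`7/5 ≤ n < 2`**, i.e. every `U ≥ 0` whenever `|n − 1| ≥ 2/5`. Then:
* `etaPairing_exclusion_of_margin_of_isTorusLimitOf` — the lever with an explicit margin `0 < m ≤ U − 2μ₊(n;U)`;
* `etaPairing_exclusion_of_strongCoupling_of_isTorusLimitOf` — `U·(1 − n) > 32/π²` (premise-free);
* `etaPairing_exclusion_of_half_lt_of_le_threeFifths_of_isTorusLimitOf` — every `U ≥ 0` on `1/2 < n ≤ 3/5` (premise-free);
* `etaPairing_exclusion_quadrant_{n3o4,n4o5,n7o8_of_six_le}_of_isTorusLimitOf`, `…_of_eight_le_of_le_twentythree_div_twentyfive_of_isTorusLimitOf`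
  — the four quadrants (floors BY NAME, caps unconditional);
* `etaPairing_exclusion_of_strongCoupling_electronDoped_of_isTorusLimitOf`, `…_of_sevenFifths_le_of_lt_threeHalves_of_isTorusLimitOf` — two mirrors.
References: C. N. Yang, PRL 63 (1989) 2144 [Yang1989]; O. Bratteli, D. W. Robinson, OAQSM 2 (1997) Prop. 5.3.19, §6.2.4
[BratteliRobinsonII1997]; D. Ruelle, *Statistical Mechanics* (1969) §3.4 [Ruelle1969]; E. H. Lieb, PRL 62 (1989) 1201 [LiebPRL1989].
-/

noncomputable section

namespace Summit.Ventures.CertifiedManyBodySolver.Observables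

open Matrix Finset Filter Literature.MathematicalPhysics.QuantumLattice Literature.Probability.LatticeModels
open Literature.MathematicalPhysics.QuantumLattice.HubbardWave0 ThermodynamicLimit
open Summit.Ventures.CertifiedManyBodySolver.Certificates
open scoped ComplexOrder Topology

/-! ### §0 The clean corollaries: EVERY `U ≥ 0` for EVERY `0 < n ≤ 3/5` and EVERY `7/5 ≤ n < 2` -/

/-- **η-PAIRING ODLRO IS ABSENT AT EVERY `U ≥ 0` FOR EVERY DENSITY `0 < n ≤ 3/5`** (`t' = 0`; premise-free): the margin
`U − 2μ₊(3/5; U) > 0` of the companion file (`sub_two_mul_chemPotPlusTT'_pos_of_half_lt_of_le_threeFifths` at `n₁ = 3/5`) inherited by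
every `n ≤ 3/5` through the monotonicity of `μ₊` — one statement replacing g15's `n < 1/2` (`U > 0`), `n = 1/2` and g16's `(1/2, 3/5]`:
`M⁻⁴ Re ω(η†_{Λ_M} η_{Λ_M}) → 0` and `Re ω(η†_Λ η_Λ) ≤ 64(|Λ'| − |Λ|)²/(U − 2μ₊(3/5;U))²` for every TI ground state `ω` of density `n`.
[cite: Yang1989, eqs. (6)–(8)] [cite: BratteliRobinsonII1997, Prop. 5.3.19] [cite: LiebWuPhysicaA2003, §7] -/
theorem etaPairing_exclusion_of_le_threeFifths {U n : ℝ} (hU : 0 ≤ U) (hn0 : 0 < n) (hn : n ≤ 3 / 5)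
    {ω : InfVolFermionState 2} (hω : ω.IsTranslationInvariant) (hρ : ω.density = n)
    (hme : ω.meanEnergy (hubbardTTPrimeFermionInteraction 1 0 U) 1 = energyDensityTT' 1 0 U n) :
    0 < U - 2 * chemPotPlusTT' 1 0 U (3 / 5) ∧
    Tendsto (fun M : ℕ =>
        (ω.expect (halfOpenBox 2 M) (etaRaise (fun w : PolySite (halfOpenBox 2 M) => siteStagger (ofLex w.1)) *
          etaLower (fun w : PolySite (halfOpenBox 2 M) => siteStagger (ofLex w.1)))).re / (M : ℝ) ^ 4)
        atTop (𝓝 0) ∧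
      ∀ {Λ Λ' : Finset (Site 2)}, Λ ⊆ Λ' → thicken Λ 1 ⊆ Λ' →
        (ω.expect Λ (etaRaise (fun w : PolySite Λ => siteStagger (ofLex w.1)) *
            etaLower (fun w : PolySite Λ => siteStagger (ofLex w.1)))).re ≤
          64 * ((#Λ' : ℝ) - #Λ) ^ 2 / (U - 2 * chemPotPlusTT' 1 0 U (3 / 5)) ^ 2 := by
  have hpos := sub_two_mul_chemPotPlusTT'_pos_of_half_lt_of_le_threeFifths hU (n := 3 / 5) (by norm_num) le_rfl
  exact ⟨hpos, etaPairing_exclusion_of_margin_at_ge hU hn0 hn (by norm_num) hpos le_rfl hω hρ hme⟩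

/-- **η-PAIRING ODLRO IS ABSENT AT EVERY `U ≥ 0` FOR EVERY DENSITY `7/5 ≤ n < 2`** (premise-free; mirror of the previous theorem):
`M⁻⁴ Re ω(η†η) → 0` and `Re ω(η†_Λ η_Λ) ≤ 64(|Λ'| − |Λ|)²/(U − 2μ₊(3/5;U))² + (n − 1)|Λ|`. Together: **every `U ≥ 0` whenever `|n − 1| ≥ 2/5`.**
[cite: LiebPRL1989, proof of Theorem 2] [cite: Yang1989, eqs. (6)–(8)] [cite: BratteliRobinsonII1997, Prop. 5.3.19] -/
theorem etaPairing_exclusion_of_sevenFifths_le {U n : ℝ} (hU : 0 ≤ U) (hn : 7 / 5 ≤ n) (hn2 : n < 2)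
    {ω : InfVolFermionState 2} (hω : ω.IsTranslationInvariant) (hρ : ω.density = n)
    (hme : ω.meanEnergy (hubbardTTPrimeFermionInteraction 1 0 U) 1 = energyDensityTT' 1 0 U n) :
    0 < U - 2 * chemPotPlusTT' 1 0 U (3 / 5) ∧
    Tendsto (fun M : ℕ =>
        (ω.expect (halfOpenBox 2 M) (etaRaise (fun w : PolySite (halfOpenBox 2 M) => siteStagger (ofLex w.1)) *
          etaLower (fun w : PolySite (halfOpenBox 2 M) => siteStagger (ofLex w.1)))).re / (M : ℝ) ^ 4)
        atTop (𝓝 0) ∧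
      ∀ {Λ Λ' : Finset (Site 2)}, Λ ⊆ Λ' → thicken Λ 1 ⊆ Λ' →
        (ω.expect Λ (etaRaise (fun w : PolySite Λ => siteStagger (ofLex w.1)) *
            etaLower (fun w : PolySite Λ => siteStagger (ofLex w.1)))).re ≤
          64 * ((#Λ' : ℝ) - #Λ) ^ 2 / (U - 2 * chemPotPlusTT' 1 0 U (3 / 5)) ^ 2 + (n - 1) * #Λ := by
  have hm0 : 0 < 2 - n := by linarith
  have hm2 : 2 - n < 2 := by linarith
  have hpos := sub_two_mul_chemPotPlusTT'_pos_of_half_lt_of_le_threeFifths hU (n := 3 / 5) (by norm_num) le_rfl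
  have h := etaPairing_exclusion_mirror (c := U - 2 * chemPotPlusTT' 1 0 U (3 / 5)) hU hm0 hm2
    (fun hω' hρ' hme' => (etaPairing_exclusion_of_le_threeFifths hU hm0 (by linarith) hω' hρ' hme').2)
    (ω := ω) hω (by rw [hρ]; ring) (by rw [hme]; congr 1; ring)
  rw [show (1 : ℝ) - (2 - n) = n - 1 by ring] at h
  exact ⟨hpos, h⟩

/-- **Every `U ≥ 0` for every `0 < n ≤ 3/5`, row class** (premise-free). [cite: Yang1989, eqs. (6)–(8)]
[cite: BratteliRobinsonII1997, Prop. 5.3.19] [cite: Ruelle1969, §3.4] -/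
theorem etaPairing_exclusion_of_le_threeFifths_of_isTorusLimitOf {U n : ℝ} (hU : 0 ≤ U) (hn0 : 0 < n) (hn : n ≤ 3 / 5)
    {Ls : ℕ → ℕ} (hLs : Tendsto Ls atTop atTop) {ψ : ∀ L, Fock (Orb (FermionTorus 2 L))}
    (hψ : ∀ L, IsGroundStateInSector (hubbardTorusTT' L 1 0 U) (rectN n L) 0 (ψ L))
    (hψ1 : ∀ j, star (ψ (Ls j)) ⬝ᵥ ψ (Ls j) = 1)
    {ω : InfVolFermionState 2} (hωlim : ω.IsTorusLimitOf ψ Ls) :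
    Tendsto (fun M : ℕ =>
        (ω.expect (halfOpenBox 2 M) (etaRaise (fun w : PolySite (halfOpenBox 2 M) => siteStagger (ofLex w.1)) *
          etaLower (fun w : PolySite (halfOpenBox 2 M) => siteStagger (ofLex w.1)))).re / (M : ℝ) ^ 4)
        atTop (𝓝 0) ∧
      ∀ {Λ Λ' : Finset (Site 2)}, Λ ⊆ Λ' → thicken Λ 1 ⊆ Λ' →
        (ω.expect Λ (etaRaise (fun w : PolySite Λ => siteStagger (ofLex w.1)) *
            etaLower (fun w : PolySite Λ => siteStagger (ofLex w.1)))).re ≤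
          64 * ((#Λ' : ℝ) - #Λ) ^ 2 / (U - 2 * chemPotPlusTT' 1 0 U (3 / 5)) ^ 2 :=
  rowClass_of_groundStateClass hU hn0.le (by linarith)
    (fun hTI hρ hme => (etaPairing_exclusion_of_le_threeFifths hU hn0 hn hTI hρ hme).2) hLs hψ hψ1 hωlim

/-! ### §1 Row-class forms of the g16 region theorems -/

/-- **THE LEVER WITH A MARGIN, row class**: `0 < m ≤ U − 2μ₊(n;U)` (`U ≥ 0`, `0 < n < 2`) ⇒ every torus limit `ω` of unit
`(rectN n L, S^z = 0)`-sector ground states of `hubbardTorusTT' L 1 0 U` has `M⁻⁴ Re ω(η†_{Λ_M} η_{Λ_M}) → 0` and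
`Re ω(η†_Λ η_Λ) ≤ 64(|Λ'| − |Λ|)²/m²`. [cite: Yang1989, eqs. (6)–(8)] [cite: BratteliRobinsonII1997, Prop. 5.3.19] [cite: Ruelle1969, §3.4] -/
theorem etaPairing_exclusion_of_margin_of_isTorusLimitOf {U n m : ℝ} (hU : 0 ≤ U) (hn0 : 0 < n) (hn2 : n < 2) (hm : 0 < m)
    (hle : m ≤ U - 2 * chemPotPlusTT' 1 0 U n)
    {Ls : ℕ → ℕ} (hLs : Tendsto Ls atTop atTop) {ψ : ∀ L, Fock (Orb (FermionTorus 2 L))}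
    (hψ : ∀ L, IsGroundStateInSector (hubbardTorusTT' L 1 0 U) (rectN n L) 0 (ψ L))
    (hψ1 : ∀ j, star (ψ (Ls j)) ⬝ᵥ ψ (Ls j) = 1)
    {ω : InfVolFermionState 2} (hωlim : ω.IsTorusLimitOf ψ Ls) :
    Tendsto (fun M : ℕ =>
        (ω.expect (halfOpenBox 2 M) (etaRaise (fun w : PolySite (halfOpenBox 2 M) => siteStagger (ofLex w.1)) *
          etaLower (fun w : PolySite (halfOpenBox 2 M) => siteStagger (ofLex w.1)))).re / (M : ℝ) ^ 4)
        atTop (𝓝 0) ∧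
      ∀ {Λ Λ' : Finset (Site 2)}, Λ ⊆ Λ' → thicken Λ 1 ⊆ Λ' →
        (ω.expect Λ (etaRaise (fun w : PolySite Λ => siteStagger (ofLex w.1)) *
            etaLower (fun w : PolySite Λ => siteStagger (ofLex w.1)))).re ≤
          64 * ((#Λ' : ℝ) - #Λ) ^ 2 / m ^ 2 :=
  rowClass_of_groundStateClass hU hn0.le hn2
    (fun hTI hρ hme => etaPairing_exclusion_of_margin hU hn0 hn2 hm hle hTI hρ hme) hLs hψ hψ1 hωlim

/-- **`U·(1 − n) > 32/π²`, row class** (`0 < n < 1`, premise-free). [cite: Yang1989, eqs. (6)–(8)] [cite: BratteliRobinsonII1997, Prop. 5.3.19]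
[cite: Ruelle1969, §3.4] -/
theorem etaPairing_exclusion_of_strongCoupling_of_isTorusLimitOf {U n : ℝ} (hU : 0 ≤ U) (hn0 : 0 < n) (hn1 : n < 1)
    (hs : 32 / Real.pi ^ 2 < U * (1 - n))
    {Ls : ℕ → ℕ} (hLs : Tendsto Ls atTop atTop) {ψ : ∀ L, Fock (Orb (FermionTorus 2 L))}
    (hψ : ∀ L, IsGroundStateInSector (hubbardTorusTT' L 1 0 U) (rectN n L) 0 (ψ L))
    (hψ1 : ∀ j, star (ψ (Ls j)) ⬝ᵥ ψ (Ls j) = 1)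
    {ω : InfVolFermionState 2} (hωlim : ω.IsTorusLimitOf ψ Ls) :
    Tendsto (fun M : ℕ =>
        (ω.expect (halfOpenBox 2 M) (etaRaise (fun w : PolySite (halfOpenBox 2 M) => siteStagger (ofLex w.1)) *
          etaLower (fun w : PolySite (halfOpenBox 2 M) => siteStagger (ofLex w.1)))).re / (M : ℝ) ^ 4)
        atTop (𝓝 0) ∧
      ∀ {Λ Λ' : Finset (Site 2)}, Λ ⊆ Λ' → thicken Λ 1 ⊆ Λ' →
        (ω.expect Λ (etaRaise (fun w : PolySite Λ => siteStagger (ofLex w.1)) *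
            etaLower (fun w : PolySite Λ => siteStagger (ofLex w.1)))).re ≤
          64 * ((#Λ' : ℝ) - #Λ) ^ 2 / (U - 32 / (Real.pi ^ 2 * (1 - n))) ^ 2 :=
  rowClass_of_groundStateClass hU hn0.le (by linarith)
    (fun hTI hρ hme => etaPairing_exclusion_of_strongCoupling hU hn0 hn1 hs hTI hρ hme) hLs hψ hψ1 hωlim

/-- **Every `U ≥ 0` on `1/2 < n ≤ 3/5`, row class** (premise-free). [cite: Yang1989, eqs. (6)–(8)] [cite: BratteliRobinsonII1997, Prop. 5.3.19]
[cite: Ruelle1969, §3.4] -/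
theorem etaPairing_exclusion_of_half_lt_of_le_threeFifths_of_isTorusLimitOf {U n : ℝ} (hU : 0 ≤ U) (hn : 1 / 2 < n)
    (hn' : n ≤ 3 / 5)
    {Ls : ℕ → ℕ} (hLs : Tendsto Ls atTop atTop) {ψ : ∀ L, Fock (Orb (FermionTorus 2 L))}
    (hψ : ∀ L, IsGroundStateInSector (hubbardTorusTT' L 1 0 U) (rectN n L) 0 (ψ L))
    (hψ1 : ∀ j, star (ψ (Ls j)) ⬝ᵥ ψ (Ls j) = 1)
    {ω : InfVolFermionState 2} (hωlim : ω.IsTorusLimitOf ψ Ls) :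
    Tendsto (fun M : ℕ =>
        (ω.expect (halfOpenBox 2 M) (etaRaise (fun w : PolySite (halfOpenBox 2 M) => siteStagger (ofLex w.1)) *
          etaLower (fun w : PolySite (halfOpenBox 2 M) => siteStagger (ofLex w.1)))).re / (M : ℝ) ^ 4)
        atTop (𝓝 0) ∧
      ∀ {Λ Λ' : Finset (Site 2)}, Λ ⊆ Λ' → thicken Λ 1 ⊆ Λ' →
        (ω.expect Λ (etaRaise (fun w : PolySite Λ => siteStagger (ofLex w.1)) *
            etaLower (fun w : PolySite Λ => siteStagger (ofLex w.1)))).re ≤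
          64 * ((#Λ' : ℝ) - #Λ) ^ 2 / (U - 2 * chemPotPlusTT' 1 0 U n) ^ 2 :=
  rowClass_of_groundStateClass hU (by linarith) (by linarith)
    (fun hTI hρ hme => etaPairing_exclusion_of_half_lt_of_le_threeFifths hU hn hn' hTI hρ hme) hLs hψ hψ1 hωlim

/-- **Quadrant `{U ≥ 4, 0 < n ≤ 3/4}`, row class** (floor node at `(4, 3/4)` BY NAME). [cite: Yang1989, eqs. (6)–(8)]
[cite: BratteliRobinsonII1997, Prop. 5.3.19] [cite: Ruelle1969, §3.4] -/
theorem etaPairing_exclusion_quadrant_n3o4_of_isTorusLimitOf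
    (h518 : DerivedNTangent34R426.derived_r426_ntangent_sq_U4_n3o4_tp0) {U n : ℝ} (hU4 : 4 ≤ U) (hn0 : 0 < n) (hn : n ≤ 3 / 4)
    {Ls : ℕ → ℕ} (hLs : Tendsto Ls atTop atTop) {ψ : ∀ L, Fock (Orb (FermionTorus 2 L))}
    (hψ : ∀ L, IsGroundStateInSector (hubbardTorusTT' L 1 0 U) (rectN n L) 0 (ψ L))
    (hψ1 : ∀ j, star (ψ (Ls j)) ⬝ᵥ ψ (Ls j) = 1)
    {ω : InfVolFermionState 2} (hωlim : ω.IsTorusLimitOf ψ Ls) :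
    Tendsto (fun M : ℕ =>
        (ω.expect (halfOpenBox 2 M) (etaRaise (fun w : PolySite (halfOpenBox 2 M) => siteStagger (ofLex w.1)) *
          etaLower (fun w : PolySite (halfOpenBox 2 M) => siteStagger (ofLex w.1)))).re / (M : ℝ) ^ 4)
        atTop (𝓝 0) ∧
      ∀ {Λ Λ' : Finset (Site 2)}, Λ ⊆ Λ' → thicken Λ 1 ⊆ Λ' →
        (ω.expect Λ (etaRaise (fun w : PolySite Λ => siteStagger (ofLex w.1)) *
            etaLower (fun w : PolySite Λ => siteStagger (ofLex w.1)))).re ≤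
          64 * ((#Λ' : ℝ) - #Λ) ^ 2 / (0.1907687224 * U - 0.463649764) ^ 2 :=
  rowClass_of_groundStateClass (by linarith) hn0.le (by linarith)
    (fun hTI hρ hme => etaPairing_exclusion_quadrant_n3o4 h518 hU4 hn0 hn hTI hρ hme) hLs hψ hψ1 hωlim

/-- **Quadrant `{U ≥ 5, 0 < n ≤ 4/5}`, row class** (floor nodes BY NAME). [cite: Yang1989, eqs. (6)–(8)]
[cite: BratteliRobinsonII1997, Prop. 5.3.19] [cite: Ruelle1969, §3.4] -/
theorem etaPairing_exclusion_quadrant_n4o5_of_isTorusLimitOf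
    (h512 : DerivedNTangent45R426.derived_r426_ntangent_sq_U4_n4o5_tp0)
    (h515 : cert_r515_HYB_GU8n4o5eom8_w3_b4_R2_ob5p2_kry1_kry2c3rel_menulite_core_twin_focert_it6000)
    {U n : ℝ} (hU5 : 5 ≤ U) (hn0 : 0 < n) (hn : n ≤ 4 / 5)
    {Ls : ℕ → ℕ} (hLs : Tendsto Ls atTop atTop) {ψ : ∀ L, Fock (Orb (FermionTorus 2 L))}
    (hψ : ∀ L, IsGroundStateInSector (hubbardTorusTT' L 1 0 U) (rectN n L) 0 (ψ L))
    (hψ1 : ∀ j, star (ψ (Ls j)) ⬝ᵥ ψ (Ls j) = 1)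
    {ω : InfVolFermionState 2} (hωlim : ω.IsTorusLimitOf ψ Ls) :
    Tendsto (fun M : ℕ =>
        (ω.expect (halfOpenBox 2 M) (etaRaise (fun w : PolySite (halfOpenBox 2 M) => siteStagger (ofLex w.1)) *
          etaLower (fun w : PolySite (halfOpenBox 2 M) => siteStagger (ofLex w.1)))).re / (M : ℝ) ^ 4)
        atTop (𝓝 0) ∧
      ∀ {Λ Λ' : Finset (Site 2)}, Λ ⊆ Λ' → thicken Λ 1 ⊆ Λ' →
        (ω.expect Λ (etaRaise (fun w : PolySite Λ => siteStagger (ofLex w.1)) *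
            etaLower (fun w : PolySite Λ => siteStagger (ofLex w.1)))).re ≤
          64 * ((#Λ' : ℝ) - #Λ) ^ 2 / (0.21079012 * U - 0.620668091) ^ 2 :=
  rowClass_of_groundStateClass (by linarith) hn0.le (by linarith)
    (fun hTI hρ hme => etaPairing_exclusion_quadrant_n4o5 h512 h515 hU5 hn0 hn hTI hρ hme) hLs hψ hψ1 hωlim

/-- **Quadrant `{U ≥ 6, 0 < n ≤ 7/8}`, row class** (SIGNED node #542 BY NAME). [cite: Yang1989, eqs. (6)–(8)]
[cite: BratteliRobinsonII1997, Prop. 5.3.19] [cite: Ruelle1969, §3.4] -/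
theorem etaPairing_exclusion_quadrant_n7o8_of_six_le_of_isTorusLimitOf
    (h542 : cert_r542_bs_GU6n7o8tp0_w3_b4_R2_ob5p2_kry1_kry2c3rel_hanK7B4D4_KN4_PR20d4_hanK8c2s_uprime)
    {U n : ℝ} (hU6 : 6 ≤ U) (hn0 : 0 < n) (hn : n ≤ 7 / 8)
    {Ls : ℕ → ℕ} (hLs : Tendsto Ls atTop atTop) {ψ : ∀ L, Fock (Orb (FermionTorus 2 L))}
    (hψ : ∀ L, IsGroundStateInSector (hubbardTorusTT' L 1 0 U) (rectN n L) 0 (ψ L))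
    (hψ1 : ∀ j, star (ψ (Ls j)) ⬝ᵥ ψ (Ls j) = 1)
    {ω : InfVolFermionState 2} (hωlim : ω.IsTorusLimitOf ψ Ls) :
    Tendsto (fun M : ℕ =>
        (ω.expect (halfOpenBox 2 M) (etaRaise (fun w : PolySite (halfOpenBox 2 M) => siteStagger (ofLex w.1)) *
          etaLower (fun w : PolySite (halfOpenBox 2 M) => siteStagger (ofLex w.1)))).re / (M : ℝ) ^ 4)
        atTop (𝓝 0) ∧
      ∀ {Λ Λ' : Finset (Site 2)}, Λ ⊆ Λ' → thicken Λ 1 ⊆ Λ' →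
        (ω.expect Λ (etaRaise (fun w : PolySite Λ => siteStagger (ofLex w.1)) *
            etaLower (fun w : PolySite Λ => siteStagger (ofLex w.1)))).re ≤
          64 * ((#Λ' : ℝ) - #Λ) ^ 2 / (0.33 : ℝ) ^ 2 :=
  rowClass_of_groundStateClass (by linarith) hn0.le (by linarith)
    (fun hTI hρ hme => etaPairing_exclusion_quadrant_n7o8_of_six_le h542 hU6 hn0 hn hTI hρ hme) hLs hψ hψ1 hωlim

/-- **`{U ≥ 8, 0 < n ≤ 23/25}`, row class** (node #534 BY NAME): bound with `(U − 2μ₊(n;U))²`, `U − 2μ₊(n;U) > 0`.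
[cite: Yang1989, eqs. (6)–(8)] [cite: BratteliRobinsonII1997, Prop. 5.3.19] [cite: Ruelle1969, §3.4] -/
theorem etaPairing_exclusion_of_eight_le_of_le_twentythree_div_twentyfive_of_isTorusLimitOf
    (h534 : DerivedNTangentR529SymN.derived_r529_ntangent_sq_U8_msym_tp0) {U n : ℝ} (hU8 : 8 ≤ U) (hn0 : 0 < n)
    (hn' : n ≤ 23 / 25)
    {Ls : ℕ → ℕ} (hLs : Tendsto Ls atTop atTop) {ψ : ∀ L, Fock (Orb (FermionTorus 2 L))}
    (hψ : ∀ L, IsGroundStateInSector (hubbardTorusTT' L 1 0 U) (rectN n L) 0 (ψ L))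
    (hψ1 : ∀ j, star (ψ (Ls j)) ⬝ᵥ ψ (Ls j) = 1)
    {ω : InfVolFermionState 2} (hωlim : ω.IsTorusLimitOf ψ Ls) :
    0 < U - 2 * chemPotPlusTT' 1 0 U n ∧
    Tendsto (fun M : ℕ =>
        (ω.expect (halfOpenBox 2 M) (etaRaise (fun w : PolySite (halfOpenBox 2 M) => siteStagger (ofLex w.1)) *
          etaLower (fun w : PolySite (halfOpenBox 2 M) => siteStagger (ofLex w.1)))).re / (M : ℝ) ^ 4)
        atTop (𝓝 0) ∧
      ∀ {Λ Λ' : Finset (Site 2)}, Λ ⊆ Λ' → thicken Λ 1 ⊆ Λ' →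
        (ω.expect Λ (etaRaise (fun w : PolySite Λ => siteStagger (ofLex w.1)) *
            etaLower (fun w : PolySite Λ => siteStagger (ofLex w.1)))).re ≤
          64 * ((#Λ' : ℝ) - #Λ) ^ 2 / (U - 2 * chemPotPlusTT' 1 0 U n) ^ 2 :=
  rowClass_of_groundStateClass (P := fun ω => 0 < U - 2 * chemPotPlusTT' 1 0 U n ∧
      Tendsto (fun M : ℕ =>
        (ω.expect (halfOpenBox 2 M) (etaRaise (fun w : PolySite (halfOpenBox 2 M) => siteStagger (ofLex w.1)) *
          etaLower (fun w : PolySite (halfOpenBox 2 M) => siteStagger (ofLex w.1)))).re / (M : ℝ) ^ 4)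
        atTop (𝓝 0) ∧
      ∀ {Λ Λ' : Finset (Site 2)}, Λ ⊆ Λ' → thicken Λ 1 ⊆ Λ' →
        (ω.expect Λ (etaRaise (fun w : PolySite Λ => siteStagger (ofLex w.1)) *
            etaLower (fun w : PolySite Λ => siteStagger (ofLex w.1)))).re ≤
          64 * ((#Λ' : ℝ) - #Λ) ^ 2 / (U - 2 * chemPotPlusTT' 1 0 U n) ^ 2)
    (by linarith) hn0.le (by linarith)
    (fun hTI hρ hme => etaPairing_exclusion_of_eight_le_of_le_twentythree_div_twentyfive h534 hU8 hn0 hn' hTI hρ hme)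
    hLs hψ hψ1 hωlim

/-- **`U·(n − 1) > 32/π²`, row class** (`1 < n < 2`, premise-free; electron-doped mirror). [cite: LiebPRL1989, proof of Theorem 2]
[cite: Yang1989, eqs. (6)–(8)] [cite: Ruelle1969, §3.4] -/
theorem etaPairing_exclusion_of_strongCoupling_electronDoped_of_isTorusLimitOf {U n : ℝ} (hU : 0 ≤ U) (hn1 : 1 < n) (hn2 : n < 2)
    (hs : 32 / Real.pi ^ 2 < U * (n - 1))
    {Ls : ℕ → ℕ} (hLs : Tendsto Ls atTop atTop) {ψ : ∀ L, Fock (Orb (FermionTorus 2 L))}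
    (hψ : ∀ L, IsGroundStateInSector (hubbardTorusTT' L 1 0 U) (rectN n L) 0 (ψ L))
    (hψ1 : ∀ j, star (ψ (Ls j)) ⬝ᵥ ψ (Ls j) = 1)
    {ω : InfVolFermionState 2} (hωlim : ω.IsTorusLimitOf ψ Ls) :
    Tendsto (fun M : ℕ =>
        (ω.expect (halfOpenBox 2 M) (etaRaise (fun w : PolySite (halfOpenBox 2 M) => siteStagger (ofLex w.1)) *
          etaLower (fun w : PolySite (halfOpenBox 2 M) => siteStagger (ofLex w.1)))).re / (M : ℝ) ^ 4)
        atTop (𝓝 0) ∧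
      ∀ {Λ Λ' : Finset (Site 2)}, Λ ⊆ Λ' → thicken Λ 1 ⊆ Λ' →
        (ω.expect Λ (etaRaise (fun w : PolySite Λ => siteStagger (ofLex w.1)) *
            etaLower (fun w : PolySite Λ => siteStagger (ofLex w.1)))).re ≤
          64 * ((#Λ' : ℝ) - #Λ) ^ 2 / (U - 32 / (Real.pi ^ 2 * (n - 1))) ^ 2 + (n - 1) * #Λ :=
  rowClass_of_groundStateClass hU (by linarith) hn2
    (fun hTI hρ hme => etaPairing_exclusion_of_strongCoupling_electronDoped hU hn1 hn2 hs hTI hρ hme) hLs hψ hψ1 hωlim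

/-- **Every `U ≥ 0` on `7/5 ≤ n < 3/2`, row class** (premise-free; electron-doped mirror). [cite: LiebPRL1989, proof of Theorem 2]
[cite: Yang1989, eqs. (6)–(8)] [cite: Ruelle1969, §3.4] -/
theorem etaPairing_exclusion_of_sevenFifths_le_of_lt_threeHalves_of_isTorusLimitOf {U n : ℝ} (hU : 0 ≤ U) (hn : 7 / 5 ≤ n)
    (hn' : n < 3 / 2)
    {Ls : ℕ → ℕ} (hLs : Tendsto Ls atTop atTop) {ψ : ∀ L, Fock (Orb (FermionTorus 2 L))}
    (hψ : ∀ L, IsGroundStateInSector (hubbardTorusTT' L 1 0 U) (rectN n L) 0 (ψ L))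
    (hψ1 : ∀ j, star (ψ (Ls j)) ⬝ᵥ ψ (Ls j) = 1)
    {ω : InfVolFermionState 2} (hωlim : ω.IsTorusLimitOf ψ Ls) :
    Tendsto (fun M : ℕ =>
        (ω.expect (halfOpenBox 2 M) (etaRaise (fun w : PolySite (halfOpenBox 2 M) => siteStagger (ofLex w.1)) *
          etaLower (fun w : PolySite (halfOpenBox 2 M) => siteStagger (ofLex w.1)))).re / (M : ℝ) ^ 4)
        atTop (𝓝 0) ∧
      ∀ {Λ Λ' : Finset (Site 2)}, Λ ⊆ Λ' → thicken Λ 1 ⊆ Λ' →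
        (ω.expect Λ (etaRaise (fun w : PolySite Λ => siteStagger (ofLex w.1)) *
            etaLower (fun w : PolySite Λ => siteStagger (ofLex w.1)))).re ≤
          64 * ((#Λ' : ℝ) - #Λ) ^ 2 / (U - 2 * chemPotPlusTT' 1 0 U (2 - n)) ^ 2 + (n - 1) * #Λ :=
  rowClass_of_groundStateClass hU (by linarith) (by linarith)
    (fun hTI hρ hme => etaPairing_exclusion_of_sevenFifths_le_of_lt_threeHalves hU hn hn' hTI hρ hme) hLs hψ hψ1 hωlim

end Summit.Ventures.CertifiedManyBodySolver.Observables
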